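import Summits.BirchSwinnertonDyer.BirchSwinnertonDyer.Theorems.Rank1ResidualJetCarrierMultKit
import Summits.BirchSwinnertonDyer.Rank1Residual.GaloisImage.FrobeniusOrderWitness
import HarnessLib

/-!
# T1 JET (cell `bsd-jet`), bucket B (carrier `q = p`, `p ∥ N` multiplicative): the record kit
# WITHOUT a (ram) witness and WITHOUT `p ≥ 5` — `ρ̄_{E,p}` onto from TWO Frobenius witnesses
# (an irreducible one and one of order `p`), every odd `p`, `p = 3` included

HONEST FRAMING (programme file `BSD-LIT2PART-PROGRAMME-v1.md` §HONESTY, verbatim): «no tranche here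
proves BSD; ARM L moves the LITERAL column of an r ≤ 1 census into the kernel-proved-modulo-named-print
column; ARM P changes what «named print» is worth.» THEOREMS ONLY (seat `bsd-jet-pv-2`, session g2;
`--supports stmt-BirchSwinnertonDyer-14418`, helper). Sequel of `Rank1ResidualJetCarrierMultKit.lean`
(g0: `JET.bsdp_of_jetRowCarrierMult_of_serreWitnesses` for `p ≥ 5` by Serre's Prop. 19 counts, and
`JET.bsdp_of_jetRowCarrierMult_of_ram` for every odd `p` by ONE (ram) witness `m ≠ p`). Those two
leave the bucket-B rows at `p = 3` (carrier `3`, split `I_n` at `3` with `3 ∣ n`) WITHOUT a (ram)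
prime `m ≠ 3` (every other multiplicative prime `m` of `E` has `3 ∣ v_m(Δ)`, or `3` is the only
multiplicative prime) with no by-name road. No new mathematics here: x11c's two-witness criterion
`GaloisImage.hasSurjectiveModNGaloisRep_of_intModel_of_irr_of_order`
(`Summits/…/Rank1Residual/GaloisImage/FrobeniusOrderWitness.lean`) certifies `ρ̄_{E,p}` onto for
ANY prime `p` from two good primes `ℓ₁, ℓ₂ ≠ p`: the Frobenius at `ℓ₁` has characteristic polynomial
`X² − a_{ℓ₁}X + ℓ₁` without a root mod `p` (the image lies in no Borel subgroup), and the Frobenius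
at `ℓ₂` has `ℓ₂ ≡ 1`, `a_{ℓ₂} ≡ 2 (mod p)` and `p² ∤ #Ẽ(𝔽_{ℓ₂})` (a non-identity unipotent, i.e. an
element of order `p`; with irreducibility and `det = χ̄_p` onto this gives `GL₂(𝔽_p)`, Serre 1972
Prop. 15 / §2.4). At a MULTIPLICATIVE odd `p` the `p`-adic tower then follows in the kernel (Tate
line, `forall_hasSurjectiveModNGaloisRep_pow_of_multiplicative_of_surj`, inside
`JET.bsdp_of_carrierMultCertificate_of_surj`), so nothing else is needed:

* `bsdp_of_jetRowCarrierMult_of_irr_of_order` — `BSD(E,p)` at an odd multiplicative `p ∥ N` for a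
  literal integer model from the bucket-B certificate, image by the two Frobenius witnesses; the
  shape of g0's `bsdp_of_jetRowCarrierMult_of_ram` with the (ram) block `(m, e)` replaced by the
  order-`p` witness `ℓ₂`. At `p = 3` this is the road for the (ram)-less bucket-B rows; at `p ≥ 5` an
  alternative to the three Serre counts.

CONDITIONAL on the READING binder `hJ : JET.JetchevDivisibilityCarrierMult` (Rank1ResidualJetDefs.lean,
p463660; audit sheet `HOME/sheets/PV2-B-GAP.md` 38c31e42 on referee C's desk) and on every published
binder (`hMcU`, `hGZK`, `hKo`, `hrec`, `hD36`, `hlev`); per pair; nothing about any particular curve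
is asserted; PARTITION: row D5 `JET@p∣N` bucket B (72 249 literal classes) — 0 moved by this file.

References: [Jetchev2008] Thm. 1.4, Cor. 1.5 (p. 812); [Serre1972] §2.4 Prop. 15, §2.8;
[Mazur1978] Prop. 6.3 (1); [SilvermanAEC2009] VII.1 Rem. 1.1, VII.5.1(b), VIII.8, C.21 Rem. 21.3;
[Kraus1989] Prop. 1–2; [Wuthrich2014] Lemma 20; [IrelandRosen1990] Prop. 5.1.2; [Miller2011LMS] Def. 1.1.
-/

set_option autoImplicit false

noncomputable section

open scoped Classical

open WeierstrassCurve Literature.NumberTheory.EllipticCurves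
  Literature.NumberTheory.EllipticCurves.ModularForms
  Literature.NumberTheory.EllipticCurves.Rank1Residual
  Literature.NumberTheory.EllipticCurves.Rank1Residual.X11RankOneCertificates
  Summit.BirchSwinnertonDyer.BirchSwinnertonDyer.Rank1Residual
  Summit.BirchSwinnertonDyer.BirchSwinnertonDyer.Rank1Residual.IntModel
  Summit.BirchSwinnertonDyer.BirchSwinnertonDyer.Rank1Residual.X11RankOne
  Summit.BirchSwinnertonDyer.Rank1Residual Summit.BirchSwinnertonDyer.Rank1Residual.X11b

namespace Summit.BirchSwinnertonDyer.Rank1Residual.JET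

/-- **`BSD(E,p)` at an odd MULTIPLICATIVE `p ∥ N` (`p = 3` included) for a literal integer model from
the bucket-B certificate (carrier `p`), image by TWO Frobenius witnesses — no (ram) prime, no
`p ≥ 5`** (support-form Kraus minimality). Kernel inputs (`decide` goals for a record): `Δ ≠ 0`; the
support `bad` of `Δ` with the per-prime Kraus test (⇒ `IsGloballyMinimal`); `p ∣ Δ`, `p ∤ c₄`
(multiplicative at `p`); good primes `ℓ₁, ℓ₂ ∉ {2, p}` with point counts `n₁, n₂` such that
(i) `X² − (ℓ₁ + 1 − n₁)X + ℓ₁` has no root mod `p` and (ii) `ℓ₂ ≡ 1`, `ℓ₂ + 1 − n₂ ≡ 2 (mod p)`,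
`p² ∤ n₂` (⇒ `ρ̄_{E,p}` onto by x11c's criterion `GaloisImage.hasSurjectiveModNGaloisRep_of_intModel_of_irr_of_order`:
an irreducible Frobenius and a Frobenius of order `p`, Serre 1972 Prop. 15); the `p`-adic tower by
the Tate line inside `JET.bsdp_of_carrierMultCertificate_of_surj`. Displayed binders: the READING
`hJ : JetchevDivisibilityCarrierMult` and the published `hMcU`, `hGZK`, `hKo`, `hrec`, `hD36`, `hlev`;
the Heegner datum (`K` with `d_K ∉ {−3,−4}`, `N`, `P` non-torsion), the certificate line
`ord_p [E(K):ℤP] ≤ ord_p c_p` AT THE CARRIER `p`, `r_an ≤ 1`, `#Ш_an = s` with `ord_p s = 0`. Output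
`BSDp W p` via `JET.bsdp_of_carrierMultCertificate_level_of_surj`. CONDITIONAL on every binder; per
pair. [cite: Jetchev2008, Cor. 1.5 (p. 812)] [cite: Serre1972, §2.4 Prop. 15]
[cite: Mazur1978, §6 Prop. 6.3 (1) (p. 153)] [cite: Kraus1989, Prop. 1 and Prop. 2]
[cite: SilvermanAEC2009, VII.1 Remark 1.1, VII.5 Prop. 5.1(b), VIII.8 and C.21 Remark 21.3]
[cite: Wuthrich2014, Lemma 20 (p. 399)] [cite: Miller2011LMS, Def. 1.1] -/
theorem bsdp_of_jetRowCarrierMult_of_irr_of_order (p : ℕ) (hp : p.Prime) (hp2 : p ≠ 2)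
    (a1 a2 a3 a4 a6 : ℤ)
    (h0 : discOf [a1, a2, a3, a4, a6] ≠ 0) (bad : List (ℕ × ℕ × ℕ)) (hprime : ∀ t ∈ bad, t.1.Prime)
    (hsupp : (discOf [a1, a2, a3, a4, a6]).natAbs = (bad.map fun t => t.1 ^ t.2.2).prod)
    (hmin : ∀ t ∈ bad,
      (¬ (t.1 : ℤ) ^ 12 ∣ discOf [a1, a2, a3, a4, a6] ∨ ¬ (t.1 : ℤ) ^ 4 ∣ c4Of [a1, a2, a3, a4, a6]) ∨
      (t.1 = 2 ∧ (16 : ℤ) ∣ c4Of [a1, a2, a3, a4, a6] ∧ (64 : ℤ) ∣ c6Of [a1, a2, a3, a4, a6] ∧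
        ¬ (((16 : ℤ) ∣ c4Of [a1, a2, a3, a4, a6] / 16 ∧
            ((32 : ℤ) ∣ c6Of [a1, a2, a3, a4, a6] / 64 ∨ (32 : ℤ) ∣ c6Of [a1, a2, a3, a4, a6] / 64 - 8)) ∨
          (4 : ℤ) ∣ c6Of [a1, a2, a3, a4, a6] / 64 + 1)) ∨
      (t.1 = 3 ∧ (3 : ℤ) ^ 8 ∣ c6Of [a1, a2, a3, a4, a6] ∧ ¬ (3 : ℤ) ^ 9 ∣ c6Of [a1, a2, a3, a4, a6]))
    (hpΔ : (p : ℤ) ∣ (⟨a1, a2, a3, a4, a6⟩ : WeierstrassCurve ℤ).Δ)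
    (hpc₄ : ¬ (p : ℤ) ∣ (⟨a1, a2, a3, a4, a6⟩ : WeierstrassCurve ℤ).c₄)
    (ℓ₁ ℓ₂ : ℕ) (hℓ₁ : ℓ₁.Prime) (hℓ₂ : ℓ₂.Prime) (h2ℓ₁ : ℓ₁ ≠ 2) (h2ℓ₂ : ℓ₂ ≠ 2)
    (hpℓ₁ : ℓ₁ ≠ p) (hpℓ₂ : ℓ₂ ≠ p)
    (hΔ₁ : ¬ (ℓ₁ : ℤ) ∣ (⟨a1, a2, a3, a4, a6⟩ : WeierstrassCurve ℤ).Δ)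
    (hΔ₂ : ¬ (ℓ₂ : ℤ) ∣ (⟨a1, a2, a3, a4, a6⟩ : WeierstrassCurve ℤ).Δ)
    {n₁ n₂ : ℕ} (hc₁ : countPoints [a1, a2, a3, a4, a6] ℓ₁ = n₁)
    (hc₂ : countPoints [a1, a2, a3, a4, a6] ℓ₂ = n₂)
    (hi : ∀ c : ZMod p, c ^ 2 - (((ℓ₁ : ℤ) + 1 - n₁ : ℤ) : ZMod p) * c + ℓ₁ ≠ 0)
    (hii : (ℓ₂ : ZMod p) = 1 ∧ (((ℓ₂ : ℤ) + 1 - n₂ : ℤ) : ZMod p) = 2 ∧ ¬ p ^ 2 ∣ n₂)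
    (hJ : JetchevDivisibilityCarrierMult)
    (hMcU : McCallum1991_padicValNat_card_sha_primary_add_le_of_globalDivisibility)
    (hGZK : rank_eq_analyticRank_of_analyticRank_le_one)
    (hKo : ∀ (N : ℕ) [NeZero N] (W : WeierstrassCurve ℚ) (K : Type) [Field K] [NumberField K],
      kolyvagin N W K)
    (hrec : ∀ (N : ℕ) [NeZero N] (W : WeierstrassCurve ℚ) (K : Type) [Field K] [NumberField K],
      heegnerPointOfConductor_one_galoisConj N W K)
    (hD36 : ∀ (N : ℕ) [NeZero N] (W : WeierstrassCurve ℚ) (K : Type) [Field K] [NumberField K],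
      phi_heegnerTau_mem_singularModuliField N W K)
    (hlev : ∀ {N : ℕ} [NeZero N], IsNewformOf.level_eq_conductorNorm (N := N))
    (W : WeierstrassCurve ℚ) (hW : W = ⟨a1, a2, a3, a4, a6⟩)
    {N : ℕ} [NeZero N] {K : Type} [Field K] [NumberField K] (hK : IsImaginaryQuadratic K)
    (hD3 : NumberField.discr K ≠ -3) (hD4 : NumberField.discr K ≠ -4)
    (hH : SatisfiesHeegnerHypothesis N K) {P : (W.baseChange K).toAffine.Point}
    (hP : IsHeegnerPoint N W K P) (hnt : ¬ IsOfFinAddOrder P)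
    (hI : (haveI := Fact.mk hp;
      padicValNat p (AddSubgroup.zmultiples P).index ≤
        padicValNat p ((W.baseChange ℚ_[p]).localTamagawaNumber ℤ_[p])))
    (hr : W.analyticRank ≤ 1) {s : ℚ} (hs : shaAn W = (s : ℂ)) (hv : padicValRat p s = 0) :
    BSDp W p := by
  subst hW
  haveI hE : (⟨a1, a2, a3, a4, a6⟩ : WeierstrassCurve ℚ).IsElliptic :=
    X11b.isElliptic_of_discOf_ne_zero a1 a2 a3 a4 a6 h0
  haveI hM : (⟨a1, a2, a3, a4, a6⟩ : WeierstrassCurve ℚ).IsGloballyMinimal :=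
    X11b.isGloballyMinimal_of_krausCriterion_support a1 a2 a3 a4 a6 bad hprime hsupp hmin
  haveI : Fact (Nat.Prime p) := ⟨hp⟩
  haveI := Fact.mk hℓ₁; haveI := Fact.mk hℓ₂
  have hI0 : integralModelInt (⟨a1, a2, a3, a4, a6⟩ : WeierstrassCurve ℚ) = ⟨a1, a2, a3, a4, a6⟩ :=
    integralModelInt_eq_of_map_eq _ (map_mk_int a1 a2 a3 a4 a6)
  -- the two witness counts in `Nat.card` form
  have hn₁ : Nat.card (((⟨a1, a2, a3, a4, a6⟩ : WeierstrassCurve ℤ).map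
      (Int.castRingHom (ZMod ℓ₁))).toAffine.Point) = n₁ := by
    exact_mod_cast (X11b.natCard_point_eq_countPoints a1 a2 a3 a4 a6 ℓ₁ h2ℓ₁ hΔ₁).trans hc₁
  have hn₂ : Nat.card (((⟨a1, a2, a3, a4, a6⟩ : WeierstrassCurve ℤ).map
      (Int.castRingHom (ZMod ℓ₂))).toAffine.Point) = n₂ := by
    exact_mod_cast (X11b.natCard_point_eq_countPoints a1 a2 a3 a4 a6 ℓ₂ h2ℓ₂ hΔ₂).trans hc₂
  -- `ρ̄_{E,p}` onto: irreducible Frobenius at `ℓ₁`, Frobenius of order `p` at `ℓ₂`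
  have hsurj : (⟨a1, a2, a3, a4, a6⟩ : WeierstrassCurve ℚ).HasSurjectiveModNGaloisRep p :=
    GaloisImage.hasSurjectiveModNGaloisRep_of_intModel_of_irr_of_order hI0 p ℓ₁ ℓ₂ hpℓ₁ hpℓ₂ hΔ₁
      hΔ₂ hn₁ hn₂ hi hii.1 hii.2.1 hii.2.2
  -- multiplicative at `p`
  have hmult : (⟨a1, a2, a3, a4, a6⟩ : WeierstrassCurve ℚ).HasMultiplicativeReductionAtPrime p :=
    hasMultiplicativeReductionAtPrime_of_intModel hI0 p hpΔ hpc₄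
  exact bsdp_of_carrierMultCertificate_level_of_surj hJ hMcU hGZK hKo hrec hD36 hlev _ p hK hD3 hD4 hH
    hP hnt hp2 hmult hsurj hI hr hs hv

end Summit.BirchSwinnertonDyer.Rank1Residual.JET

end
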